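import Summits.AtomisticToContinuum.HydrodynamicLimit.Theorems.AntiMazurCoboundariesKineticWindowGronwallFamilyGluePrelim
import Summits.AtomisticToContinuum.HydrodynamicLimit.Theorems.AntiMazurCoboundariesKineticWindowGronwallPlusNode
import Summits.AtomisticToContinuum.HydrodynamicLimit.Theorems.AntiMazurCoboundariesKineticWindowGronwallWindowEnergyMoment
import Summits.AtomisticToContinuum.HydrodynamicLimit.Theorems.AntiMazurCoboundariesKineticWindowGronwallTailReorth
import HarnessLib

/-!
# The general-`F` family glue: the bounds-uniform profile-wise node gives window LD for GENERAL fast functionals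
# along jointly continuous families (line `rare-band-ladder-dock` v7, crux `KineticWindowGronwall`, stmt-9282)

Crux `Summit.AtomisticToContinuum.HydrodynamicLimit.Theses.AntiMazurCoboundaries.KineticWindowGronwall`. File 3 of the v7 glue
(`…FamilyGlue.lean`) proved that thresholds pointwise in the local Gibbs profile upgrade to thresholds uniform along families for
the line's PRODUCT class. This file proves the same for GENERAL jointly continuous families `s ↦ F_s(x, v)` of quadratic growth,
orthogonal at every `x` under the local Maxwellian of the family — the class of TwoClocks 14442 / OneFlightGossipEngine 16659 —
from the wall node in TwoClocks' vocabulary `KineticWindowLDBoundsUniform` (landed `…PlusNode.lean`), GIVEN the static change of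
measure `TwoProfileTransfer` (registered stub of the line): `KineticWindowLDAlongFamiliesGeneral`. The proof is the s-net of file 3
with a simpler comparison (no frame closeness is needed for a lab-frame family; `PlusNode.general_compare_avg`): bulk modulus of
`(s, x, v) ↦ F_s(x, v)` on the compact `[0,t₁] × 𝕋³ × B̄(0, U + √θM R)`, quadratic envelopes on the tail, the tail weight of
`TailReorth` read in the thermal frame of the net point and re-orthogonalised there (`orth_localMaxwellian_of_orth`), energy
conservation for the small quadratic remainder (`stub_windowEnergyMoment`), three-piece inequality rank split, order-2 Rényi
change of measure between the laws at `s` and at the net point. Consequence (file `…AlongFamiliesDock`): the ONE wall node implies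
OneFlightGossipEngine's crux `KineticCurrentsLDAlongFamilies` (stmt-16659) outright.
-/

noncomputable section

namespace Summit.AtomisticToContinuum.HydrodynamicLimit.Theorems.KineticWindowGronwallFamilyGlue

open MeasureTheory Set Filter Metric
open scoped ENNReal BigOperators
open Literature.Analysis.FluidPDE Literature.MathematicalPhysics.KineticTheory

/-! ## §1 Statements -/

/-- **WINDOW LD FOR GENERAL FAST FUNCTIONALS ALONG FAMILIES** — OneFlightGossipEngine's `KineticCurrentsLDAlongFamilies`
(stmt-16659) with its structured `(A, b, G)` member replaced by an ARBITRARY jointly continuous family `s ↦ F_s(x, v)` of quadratic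
growth (uniformly on `[0,t₁]`), orthogonal at every `x` under `M_{1, u_s(x), θ_s(x)}` for `s ∈ [0,t₁]`: `∃ β₀ ∀ |β| ≤ β₀ ∀ ε ∃ τ₀ ∀ τ ≥ τ₀
∃ N₀ ∀ N ≥ N₀ ∀ s ∈ [0,t₁]`, `∫ exp(β Σᵢ w_N⁻¹∫₀^{w_N} F_s(xᵢ(r), vᵢ(r)) dr) dλ^N_s ≤ e^{ε(N+1)}`. A strengthening of 16659. -/
def KineticWindowLDAlongFamiliesGeneral : Prop :=
  ∃ η₀ : ℝ, 0 < η₀ ∧ ∀ (t₁ : ℝ) (a θ₀ : ℝ → T3 → ℝ) (u₀ : ℝ → T3 → V3),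
    Continuous (Function.uncurry a) → Continuous (Function.uncurry θ₀) → Continuous (Function.uncurry u₀) →
    (∀ s x, 0 < a s x) → (∀ s x, 0 < θ₀ s x) →
    ∀ σ : ℝ, 0 < σ → (∀ s ∈ Set.Icc 0 t₁, σ ^ 3 * (⨆ x, a s x) ≤ η₀ * ∫ x, a s x) →
    ∀ Φ : (N : ℕ) → TFlow σ N,
    ∀ F : ℝ → T3 × V3 → ℝ, Continuous (Function.uncurry F) →
    (∃ C : ℝ, ∀ s ∈ Set.Icc 0 t₁, ∀ y : T3 × V3, |F s y| ≤ C * (1 + ‖y.2‖ ^ 2)) →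
    (∀ s ∈ Set.Icc 0 t₁, ∀ x, ∫ v, F s (x, v) * localMaxwellian 1 (θ₀ s x) (u₀ s x) v = 0) →
    (∀ s ∈ Set.Icc 0 t₁, ∀ x (j : Fin 3), ∫ v, F s (x, v) * v j * localMaxwellian 1 (θ₀ s x) (u₀ s x) v = 0) →
    (∀ s ∈ Set.Icc 0 t₁, ∀ x, ∫ v, F s (x, v) * ‖v‖ ^ 2 * localMaxwellian 1 (θ₀ s x) (u₀ s x) v = 0) →
    ∃ β₀ : ℝ, 0 < β₀ ∧ ∀ β : ℝ, |β| ≤ β₀ → ∀ ε : ℝ, 0 < ε → ∃ τ₀ : ℝ, 0 < τ₀ ∧ ∀ τ : ℝ, τ₀ ≤ τ →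
    ∃ N₀ : ℕ, ∀ N : ℕ, N₀ ≤ N → ∀ s ∈ Set.Icc 0 t₁,
      ∫⁻ z, ENNReal.ofReal (Real.exp (β * ∑ i : Fin (N + 1),
          (τ * ((N : ℝ) + 1) ^ (-(1 / 3 : ℝ)))⁻¹ *
            ∫ r in (0 : ℝ)..(τ * ((N : ℝ) + 1) ^ (-(1 / 3 : ℝ))), F s ((Φ N).flow r z i)))
        ∂(localGibbsLaw σ (a s) (u₀ s) (θ₀ s) N (Φ N)) ≤
      ENNReal.ofReal (Real.exp (ε * ((N : ℝ) + 1)))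

/-- Helper statement `GeneralFamilyGlue` (registered helper stub `stub_generalFamilyGlue` of the line, supports 9282): the
wall node in TwoClocks' vocabulary gives, modulo the static change of measure `TwoProfileTransfer` (registered stub), the
general-`F` node along families. Route-internal, not a cited fact. -/
def GeneralFamilyGlue : Prop :=
  TwoProfileTransfer → KineticWindowGronwallPlusNode.KineticWindowLDBoundsUniform → KineticWindowLDAlongFamiliesGeneral

/-! ## §2 The glue -/

/-- **THE GENERAL-`F` FAMILY GLUE** (`stub_generalFamilyGlue`). See the module docstring. [cite: OllaVaradhanYau1993, §3] -/
theorem stub_generalFamilyGlue : GeneralFamilyGlue := by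
  intro hT hB
  obtain ⟨η₀, hη₀, HB⟩ := hB
  refine ⟨min η₀ (1 / 16), lt_min hη₀ (by norm_num), ?_⟩
  intro t₁ a θ₀ u₀ hac hθc huc ha0 hθ0 σ hσ hguard Φ F hFc hFC hO1 hO2 hO3
  rcases lt_or_ge t₁ 0 with ht₁ | ht₁
  · refine ⟨1, one_pos, fun β _ ε _ => ⟨1, one_pos, fun τ _ => ⟨0, fun N _ s hs => ?_⟩⟩⟩
    exact absurd (hs.1.trans hs.2) (not_le.2 ht₁)
  have hac_s : ∀ s, Continuous (a s) := fun s => hac.uncurry_left s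
  have hθc_s : ∀ s, Continuous (θ₀ s) := fun s => hθc.uncurry_left s
  have huc_s : ∀ s, Continuous (u₀ s) := fun s => huc.uncurry_left s
  have hFc_s : ∀ s, Continuous (F s) := fun s => hFc.uncurry_left s
  -- bounds of the family on the slab, `σ ≤ 1/2`
  obtain ⟨θm, θM, ⟨sₘ, hsₘ, xₘ, hθmeq⟩, hθm_le, hθM_ge⟩ := exists_slab_bounds hθc ht₁
  have hθm : 0 < θm := by rw [← hθmeq]; exact hθ0 sₘ xₘ
  have hθmM : θm ≤ θM := (hθm_le sₘ hsₘ xₘ).trans (hθM_ge sₘ hsₘ xₘ)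
  have hθM : 0 < θM := hθm.trans_le hθmM
  have hun : Continuous (Function.uncurry fun s x => ‖u₀ s x‖) := huc.norm
  obtain ⟨-, U, -, -, hU_ge⟩ := exists_slab_bounds hun ht₁
  have h0mem : (0 : ℝ) ∈ Icc (0 : ℝ) t₁ := ⟨le_rfl, ht₁⟩
  have hU : 0 ≤ U := (norm_nonneg _).trans (hU_ge 0 h0mem 0)
  have hσ2 : σ ≤ 1 / 2 := sigma_le_half_of_guard (hac_s 0) (ha0 0) (min_le_right _ _) (hguard 0 h0mem)
  -- the node at the bounds, the energy constants, the normalisation, the tilt radius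
  obtain ⟨βB, hβB, HcB⟩ := HB θm θM U hθm hθmM hU σ hσ
  obtain ⟨lam₀, hlam₀, CE, hCE, HE⟩ :=
    KineticWindowGronwallWindowEnergyMoment.stub_windowEnergyMoment θM U hθM hU
  have hK₂ : 1 ≤ C₂ θm U := one_le_C₂ (U := U) hθm
  have hK₃ : 1 ≤ C₃ θM U := one_le_C₃ (U := U) hθM
  have hK₂0 : 0 < C₂ θm U := by linarith
  have hK₃0 : 0 < C₃ θM U := by linarith
  obtain ⟨C, hC⟩ := hFC
  obtain ⟨C', hC'def⟩ : ∃ C' : ℝ, C' = max C 1 := ⟨_, rfl⟩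
  have hC'1 : 1 ≤ C' := by rw [hC'def]; exact le_max_right _ _
  have hC'0 : 0 < C' := by linarith
  have hCC' : C ≤ C' := by rw [hC'def]; exact le_max_left _ _
  have hFb : ∀ s ∈ Icc (0 : ℝ) t₁, ∀ y : T3 × V3, |F s y| ≤ C' * (1 + ‖y.2‖ ^ 2) := fun s hs y =>
    (hC s hs y).trans (mul_le_mul_of_nonneg_right hCC' (by positivity))
  obtain ⟨β₀, hβ₀def⟩ : ∃ β₀ : ℝ, β₀ = βB / (24 * C' * C₂ θm U * C₃ θM U) := ⟨_, rfl⟩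
  have hβ₀ : 0 < β₀ := by rw [hβ₀def]; positivity
  have h24 : 24 * β₀ * C' * C₃ θM U * C₂ θm U = βB := by rw [hβ₀def]; field_simp
  have h6 : 6 * β₀ * C' ≤ βB := by
    have h1 : 1 ≤ C₃ θM U * C₂ θm U := by nlinarith
    have : 6 * β₀ * C' * 1 ≤ 6 * β₀ * C' * (C₃ θM U * C₂ θm U) := mul_le_mul_of_nonneg_left h1 (by positivity)
    nlinarith
  refine ⟨β₀, hβ₀, fun β hβ ε hε => ?_⟩
  have hβabs : |β| ≤ β₀ := hβ
  -- the effective accuracy and the budgets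
  obtain ⟨ε', hε'def⟩ : ∃ ε' : ℝ, ε' = min ε (CE * lam₀) := ⟨_, rfl⟩
  have hε' : 0 < ε' := by rw [hε'def]; exact lt_min hε (mul_pos hCE hlam₀)
  have hε'ε : ε' ≤ ε := by rw [hε'def]; exact min_le_left _ _
  have hε'C : ε' ≤ CE * lam₀ := by rw [hε'def]; exact min_le_right _ _
  have hε'2 : 0 < ε' / 2 := by positivity
  obtain ⟨B₀, hB₀def⟩ : ∃ B₀ : ℝ, B₀ = ε' / (36 * CE) := ⟨_, rfl⟩
  have hB₀ : 0 < B₀ := by rw [hB₀def]; positivity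
  obtain ⟨η, hηdef⟩ : ∃ η : ℝ, η = B₀ / (β₀ + 1) := ⟨_, rfl⟩
  have hη : 0 < η := by rw [hηdef]; positivity
  obtain ⟨ηt, hηtdef⟩ : ∃ ηt : ℝ, ηt = min 1 (B₀ / (2 * β₀ * C' * C₃ θM U * (1 + C₂ θm U) + 1)) := ⟨_, rfl⟩
  have hηt : 0 < ηt := by rw [hηtdef]; exact lt_min one_pos (by positivity)
  have hηt1 : ηt ≤ 1 := by rw [hηtdef]; exact min_le_left _ _
  obtain ⟨Λ, hΛdef⟩ : ∃ Λ : ℝ, Λ = β₀ * η + 2 * β₀ * C' * C₃ θM U * ηt * (1 + C₂ θm U) := ⟨_, rfl⟩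
  have hΛ0 : 0 ≤ Λ := by rw [hΛdef]; positivity
  have hΛ : Λ ≤ 2 * B₀ := by
    have h1 : β₀ * η ≤ B₀ := by
      have e : η * (β₀ + 1) = B₀ := by rw [hηdef]; field_simp
      have h : η * β₀ ≤ η * (β₀ + 1) := mul_le_mul_of_nonneg_left (le_add_of_nonneg_right zero_le_one) hη.le
      linarith [mul_comm β₀ η]
    have h3 : 2 * β₀ * C' * C₃ θM U * ηt * (1 + C₂ θm U) ≤ B₀ := by
      have hpos : 0 < 2 * β₀ * C' * C₃ θM U * (1 + C₂ θm U) + 1 := by positivity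
      have hle : ηt ≤ B₀ / (2 * β₀ * C' * C₃ θM U * (1 + C₂ θm U) + 1) := by rw [hηtdef]; exact min_le_right _ _
      have h := (le_div_iff₀ hpos).1 hle
      have h' : ηt * (2 * β₀ * C' * C₃ θM U * (1 + C₂ θm U)) ≤ ηt * (2 * β₀ * C' * C₃ θM U * (1 + C₂ θm U) + 1) :=
        mul_le_mul_of_nonneg_left (le_add_of_nonneg_right zero_le_one) hηt.le
      calc 2 * β₀ * C' * C₃ θM U * ηt * (1 + C₂ θm U) = ηt * (2 * β₀ * C' * C₃ θM U * (1 + C₂ θm U)) := by ring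
        _ ≤ _ := h'
        _ ≤ B₀ := h
    rw [hΛdef]; linarith
  have hCElam : CE * (6 * Λ) ≤ ε' / 2 := by
    have : CE * (6 * Λ) ≤ CE * (12 * B₀) := mul_le_mul_of_nonneg_left (by linarith) hCE.le
    have h12 : CE * (12 * B₀) = ε' / 3 := by rw [hB₀def]; field_simp; ring
    linarith
  have hlam0 : 0 ≤ 6 * Λ := by positivity
  have hlamle : 6 * Λ ≤ lam₀ := le_of_mul_le_mul_left (by linarith : CE * (6 * Λ) ≤ CE * lam₀) hCE
  -- the tail cut-off and its re-orthogonalised core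
  obtain ⟨R, -, hR1, t, α, γ, htc, hα, hγ, ht0, ht1, htR, -, htorth⟩ :=
    KineticWindowGronwallTailReorth.stub_tailReorth ηt hηt 0
  have hR0 : 0 ≤ R := zero_le_one.trans hR1
  let t₀ : V3 → ℝ := fun w => t w - (α + γ * ‖w‖ ^ 2)
  have ht₀c : Continuous t₀ := htc.sub (continuous_const.add (continuous_const.mul (continuous_norm.pow 2)))
  have hsplit : ∀ w, t w = t₀ w + (α + γ * ‖w‖ ^ 2) := fun w => by simp only [t₀]; ring
  have ht₀b : ∀ w, |t₀ w| ≤ 2 * (1 + ‖w‖ ^ 2) := by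
    intro w
    have h1 : |t w| ≤ 1 + ‖w‖ ^ 2 := by rw [abs_of_nonneg (ht0 w)]; exact ht1 w
    have h2 : |α| ≤ 1 := hα.trans hηt1
    have h3 : |γ * ‖w‖ ^ 2| ≤ ‖w‖ ^ 2 := by
      rw [abs_mul, abs_of_nonneg (sq_nonneg ‖w‖)]
      exact (mul_le_mul_of_nonneg_right (hγ.trans hηt1) (sq_nonneg _)).trans (one_mul _).le
    have h4 : |t₀ w| ≤ |t w| + (|α| + |γ * ‖w‖ ^ 2|) := (abs_sub _ _).trans (by gcongr; exact abs_add_le _ _)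
    linarith
  have ht₀o : KineticWindowGronwallLadder.Orth t₀ := htorth
  -- the bulk modulus of the family `F` on `[0,t₁] × 𝕋³ × B̄(0, Rv)`
  have hsqm : 0 < Real.sqrt θm := Real.sqrt_pos.2 hθm
  obtain ⟨Rv, hRvdef⟩ : ∃ Rv : ℝ, Rv = U + Real.sqrt θM * R := ⟨_, rfl⟩
  obtain ⟨δF, hδF, HδF⟩ : ∃ δF : ℝ, 0 < δF ∧ ∀ p ∈ Icc (0 : ℝ) t₁ ×ˢ ((univ : Set T3) ×ˢ closedBall (0 : V3) Rv),
      ∀ q ∈ Icc (0 : ℝ) t₁ ×ˢ ((univ : Set T3) ×ˢ closedBall (0 : V3) Rv),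
      dist p q < δF → dist (Function.uncurry F p) (Function.uncurry F q) < η := by
    have hK : IsCompact (Icc (0 : ℝ) t₁ ×ˢ ((univ : Set T3) ×ˢ closedBall (0 : V3) Rv)) :=
      isCompact_Icc.prod (isCompact_univ.prod (isCompact_closedBall _ _))
    have hUg := hK.uniformContinuousOn_of_continuous hFc.continuousOn
    rw [Metric.uniformContinuousOn_iff] at hUg
    exact hUg η hη
  have hbulk : ∀ s ∈ Icc (0 : ℝ) t₁, ∀ s' ∈ Icc (0 : ℝ) t₁, |s - s'| ≤ δF / 2 → ∀ (x : T3) (v : V3),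
      ‖v‖ ≤ U + Real.sqrt θM * R → |F s (x, v) - F s' (x, v)| ≤ η := by
    intro s hs s' hs' hss x v hv
    rw [← hRvdef] at hv
    have hm : ∀ r ∈ Icc (0 : ℝ) t₁, ((r, (x, v)) : ℝ × (T3 × V3)) ∈
        Icc (0 : ℝ) t₁ ×ˢ ((univ : Set T3) ×ˢ closedBall (0 : V3) Rv) := fun r hr =>
      ⟨hr, mem_univ _, by rwa [mem_closedBall, dist_zero_right]⟩
    have hd : dist ((s, (x, v)) : ℝ × (T3 × V3)) (s', (x, v)) < δF := by
      rw [Prod.dist_eq, dist_self, max_eq_left dist_nonneg, Real.dist_eq]; linarith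
    have := HδF _ (hm s hs) _ (hm s' hs') hd
    simp only [Function.uncurry_apply_pair, Real.dist_eq] at this
    exact this.le
  -- the Rényi tolerance and the slab moduli of `log a`, `θ₀`, `u₀`
  obtain ⟨ρ, hρ, HT⟩ := hT θm θM hθm hθmM (ε' / 4) (by positivity)
  have hlogc : Continuous (Function.uncurry fun s x => Real.log (a s x)) := hac.log fun p => (ha0 p.1 p.2).ne'
  obtain ⟨δ₁, hδ₁, Hδ₁⟩ := exists_slab_modulus hlogc t₁ hρ
  obtain ⟨δ₂, hδ₂, Hδ₂⟩ := exists_slab_modulus hθc t₁ hρ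
  obtain ⟨δ₃, hδ₃, Hδ₃⟩ := exists_slab_modulus huc t₁ hρ
  obtain ⟨δs, hδsdef⟩ : ∃ δs : ℝ, δs = min (min δ₁ δ₂) (min δ₃ (δF / 2)) := ⟨_, rfl⟩
  have hδs : 0 < δs := by rw [hδsdef]; exact lt_min (lt_min hδ₁ hδ₂) (lt_min hδ₃ (by positivity))
  have hδs1 : δs ≤ δ₁ := hδsdef ▸ (min_le_left _ _).trans (min_le_left _ _)
  have hδs2 : δs ≤ δ₂ := hδsdef ▸ (min_le_left _ _).trans (min_le_right _ _)
  have hδs3 : δs ≤ δ₃ := hδsdef ▸ (min_le_right _ _).trans (min_le_left _ _)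
  have hδs4 : δs ≤ δF / 2 := hδsdef ▸ (min_le_right _ _).trans (min_le_right _ _)
  obtain ⟨Kmax, hKmaxdef⟩ : ∃ K : ℕ, K = ⌊t₁ / δs⌋₊ := ⟨_, rfl⟩
  let sk : Fin (Kmax + 1) → ℝ := fun k => (k : ℝ) * δs
  have hsk_mem : ∀ k, sk k ∈ Icc (0 : ℝ) t₁ := by
    intro k
    refine ⟨by positivity, ?_⟩
    have hk : ((k : ℕ) : ℝ) ≤ (Kmax : ℝ) := by exact_mod_cast Nat.lt_succ_iff.1 k.2
    calc ((k : ℕ) : ℝ) * δs ≤ (Kmax : ℝ) * δs := mul_le_mul_of_nonneg_right hk hδs.le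
      _ ≤ t₁ / δs * δs := by
          rw [hKmaxdef]; exact mul_le_mul_of_nonneg_right (Nat.floor_le (div_nonneg ht₁ hδs.le)) hδs.le
      _ = t₁ := div_mul_cancel₀ t₁ hδs.ne'
  have hguardk : ∀ k, σ ^ 3 * (⨆ x, a (sk k) x) ≤ η₀ * ∫ x, a (sk k) x := fun k =>
    (hguard (sk k) (hsk_mem k)).trans
      (mul_le_mul_of_nonneg_right (min_le_left _ _) (integral_nonneg fun x => (ha0 _ x).le))
  -- the two normalised members fed to the node at the net points
  let Fn : Fin (Kmax + 1) → T3 × V3 → ℝ := fun k y => C'⁻¹ * F (sk k) y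
  let Gn : Fin (Kmax + 1) → T3 × V3 → ℝ := fun k y =>
    (2 * C₂ θm U)⁻¹ * ((fun _ : T3 => (1 : ℝ)) y.1 *
      t₀ ((Real.sqrt (θ₀ (sk k) y.1))⁻¹ • (y.2 - u₀ (sk k) y.1)))
  have hFnc : ∀ k, Continuous (Fn k) := fun k => continuous_const.mul (hFc_s _)
  have hGnc : ∀ k, Continuous (Gn k) := fun k =>
    continuous_const.mul (continuous_productObs (φ := fun _ => (1 : ℝ)) continuous_const (hθc_s _) (hθ0 _)
      (huc_s _) ht₀c)
  have hFnb : ∀ k y, |Fn k y| ≤ 1 + ‖y.2‖ ^ 2 := by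
    intro k y
    show |C'⁻¹ * F (sk k) y| ≤ 1 + ‖y.2‖ ^ 2
    rw [abs_mul, abs_inv, abs_of_pos hC'0]
    calc C'⁻¹ * |F (sk k) y| ≤ C'⁻¹ * (C' * (1 + ‖y.2‖ ^ 2)) :=
          mul_le_mul_of_nonneg_left (hFb _ (hsk_mem k) y) (inv_nonneg.2 hC'0.le)
      _ = 1 + ‖y.2‖ ^ 2 := by field_simp
  have hGnb : ∀ k y, |Gn k y| ≤ 1 + ‖y.2‖ ^ 2 := by
    intro k y
    show |(2 * C₂ θm U)⁻¹ * ((fun _ : T3 => (1 : ℝ)) y.1 *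
      t₀ ((Real.sqrt (θ₀ (sk k) y.1))⁻¹ • (y.2 - u₀ (sk k) y.1)))| ≤ 1 + ‖y.2‖ ^ 2
    rw [abs_mul, abs_inv, abs_of_pos (by positivity : (0 : ℝ) < 2 * C₂ θm U), one_mul]
    have h1 := ht₀b ((Real.sqrt (θ₀ (sk k) y.1))⁻¹ • (y.2 - u₀ (sk k) y.1))
    have h2 := one_add_norm_sq_frame_le hθm (hθm_le _ (hsk_mem k) y.1) (hU_ge _ (hsk_mem k) y.1) y.2
    calc (2 * C₂ θm U)⁻¹ * |t₀ ((Real.sqrt (θ₀ (sk k) y.1))⁻¹ • (y.2 - u₀ (sk k) y.1))|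
        ≤ (2 * C₂ θm U)⁻¹ * (2 * (C₂ θm U * (1 + ‖y.2‖ ^ 2))) :=
          mul_le_mul_of_nonneg_left (h1.trans (by linarith)) (by positivity)
      _ = 1 + ‖y.2‖ ^ 2 := by field_simp
  have hFnO : ∀ k, (∀ x, ∫ v, Fn k (x, v) * localMaxwellian 1 (θ₀ (sk k) x) (u₀ (sk k) x) v = 0) ∧
      (∀ x (j : Fin 3), ∫ v, Fn k (x, v) * v j * localMaxwellian 1 (θ₀ (sk k) x) (u₀ (sk k) x) v = 0) ∧
      (∀ x, ∫ v, Fn k (x, v) * ‖v‖ ^ 2 * localMaxwellian 1 (θ₀ (sk k) x) (u₀ (sk k) x) v = 0) := by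
    intro k
    refine ⟨fun x => ?_, fun x j => ?_, fun x => ?_⟩
    · have e : (fun v => Fn k (x, v) * localMaxwellian 1 (θ₀ (sk k) x) (u₀ (sk k) x) v) =
          fun v => C'⁻¹ * (F (sk k) (x, v) * localMaxwellian 1 (θ₀ (sk k) x) (u₀ (sk k) x) v) := by
        funext v; simp only [Fn]; ring
      rw [e, integral_const_mul, hO1 _ (hsk_mem k) x, mul_zero]
    · have e : (fun v => Fn k (x, v) * v j * localMaxwellian 1 (θ₀ (sk k) x) (u₀ (sk k) x) v) =
          fun v => C'⁻¹ * (F (sk k) (x, v) * v j * localMaxwellian 1 (θ₀ (sk k) x) (u₀ (sk k) x) v) := by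
        funext v; simp only [Fn]; ring
      rw [e, integral_const_mul, hO2 _ (hsk_mem k) x j, mul_zero]
    · have e : (fun v => Fn k (x, v) * ‖v‖ ^ 2 * localMaxwellian 1 (θ₀ (sk k) x) (u₀ (sk k) x) v) =
          fun v => C'⁻¹ * (F (sk k) (x, v) * ‖v‖ ^ 2 * localMaxwellian 1 (θ₀ (sk k) x) (u₀ (sk k) x) v) := by
        funext v; simp only [Fn]; ring
      rw [e, integral_const_mul, hO3 _ (hsk_mem k) x, mul_zero]
  have hGnO := fun k x =>
    KineticWindowGronwallRareBandDock.orth_localMaxwellian_of_orth (hθ0 (sk k) x) (u₀ (sk k) x) ht₀o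
      (2 * C₂ θm U)⁻¹ (fun _ : T3 => (1 : ℝ)) x
  have hβ1 : |6 * β * C'| ≤ βB := by
    rw [abs_mul, abs_mul, Nat.abs_ofNat, abs_of_pos hC'0]
    calc 6 * |β| * C' ≤ 6 * β₀ * C' := by gcongr
      _ ≤ βB := h6
  have hβ3 : |24 * β₀ * C' * C₃ θM U * C₂ θm U| ≤ βB := by rw [abs_of_pos (by positivity), h24]
  have H1 := fun k : Fin (Kmax + 1) =>
    HcB (a (sk k)) (θ₀ (sk k)) (u₀ (sk k)) (hac_s _) (hθc_s _) (huc_s _) (ha0 _)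
      (hθm_le _ (hsk_mem k)) (hθM_ge _ (hsk_mem k)) (hU_ge _ (hsk_mem k)) (hguardk k) Φ
      (Fn k) (hFnc k) (hFnb k) (hFnO k).1 (hFnO k).2.1 (hFnO k).2.2 (6 * β * C') hβ1 (ε' / 2) hε'2
  have H2 := fun k : Fin (Kmax + 1) =>
    HcB (a (sk k)) (θ₀ (sk k)) (u₀ (sk k)) (hac_s _) (hθc_s _) (huc_s _) (ha0 _)
      (hθm_le _ (hsk_mem k)) (hθM_ge _ (hsk_mem k)) (hU_ge _ (hsk_mem k)) (hguardk k) Φ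
      (Gn k) (hGnc k) (hGnb k) (fun x => (hGnO k x).1) (fun x => (hGnO k x).2.1) (fun x => (hGnO k x).2.2)
      (24 * β₀ * C' * C₃ θM U * C₂ θm U) hβ3 (ε' / 2) hε'2
  choose τ1 hτ1 Hτ1 using H1
  choose τ2 hτ2 Hτ2 using H2
  obtain ⟨τ₀, hτ₀def⟩ : ∃ τ₀ : ℝ,
      τ₀ = max (Finset.univ.sup' Finset.univ_nonempty τ1) (Finset.univ.sup' Finset.univ_nonempty τ2) := ⟨_, rfl⟩
  have hτ₀1 : ∀ k, τ1 k ≤ τ₀ := fun k => hτ₀def ▸ (Finset.le_sup' τ1 (Finset.mem_univ k)).trans (le_max_left _ _)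
  have hτ₀2 : ∀ k, τ2 k ≤ τ₀ := fun k => hτ₀def ▸ (Finset.le_sup' τ2 (Finset.mem_univ k)).trans (le_max_right _ _)
  have hτ₀ : 0 < τ₀ := (hτ1 0).trans_le (hτ₀1 0)
  refine ⟨τ₀, hτ₀, fun τ hτ => ?_⟩
  have hτpos : 0 < τ := hτ₀.trans_le hτ
  have H1' := fun k : Fin (Kmax + 1) => Hτ1 k τ ((hτ₀1 k).trans hτ)
  have H2' := fun k : Fin (Kmax + 1) => Hτ2 k τ ((hτ₀2 k).trans hτ)
  choose N1 HN1 using H1'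
  choose N2 HN2 using H2'
  obtain ⟨N₀, hN₀def⟩ : ∃ N₀ : ℕ,
      N₀ = max (Finset.univ.sup' Finset.univ_nonempty N1) (Finset.univ.sup' Finset.univ_nonempty N2) := ⟨_, rfl⟩
  have hN₀1 : ∀ k, N1 k ≤ N₀ := fun k => hN₀def ▸ (Finset.le_sup' N1 (Finset.mem_univ k)).trans (le_max_left _ _)
  have hN₀2 : ∀ k, N2 k ≤ N₀ := fun k => hN₀def ▸ (Finset.le_sup' N2 (Finset.mem_univ k)).trans (le_max_right _ _)
  refine ⟨N₀, fun N hN s hs => ?_⟩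
  have hN1pos : (0 : ℝ) < (N : ℝ) + 1 := by positivity
  have hℓ : (0 : ℝ) < ((N : ℝ) + 1) ^ (-(1 / 3 : ℝ)) := Real.rpow_pos_of_pos hN1pos _
  let w : ℝ := τ * ((N : ℝ) + 1) ^ (-(1 / 3 : ℝ))
  have hw : 0 < w := mul_pos hτpos hℓ
  obtain ⟨k₀, hk₀def⟩ : ∃ k₀ : ℕ, k₀ = ⌊s / δs⌋₊ := ⟨_, rfl⟩
  have hk₀ : k₀ ≤ Kmax := by rw [hk₀def, hKmaxdef]; exact Nat.floor_mono (div_le_div_of_nonneg_right hs.2 hδs.le)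
  let kf : Fin (Kmax + 1) := ⟨k₀, Nat.lt_succ_of_le hk₀⟩
  let s' : ℝ := sk kf
  have hs'eq : s' = (k₀ : ℝ) * δs := rfl
  have hs' : s' ∈ Icc (0 : ℝ) t₁ := hsk_mem kf
  have hss' : |s - s'| ≤ δs := by
    have h1 : s' ≤ s := by
      rw [hs'eq, hk₀def]
      calc (⌊s / δs⌋₊ : ℝ) * δs ≤ s / δs * δs :=
            mul_le_mul_of_nonneg_right (Nat.floor_le (div_nonneg hs.1 hδs.le)) hδs.le
        _ = s := div_mul_cancel₀ s hδs.ne'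
    have h2 : s < s' + δs := by
      rw [hs'eq, hk₀def]
      have h3 : s / δs * δs < ((⌊s / δs⌋₊ : ℝ) + 1) * δs := mul_lt_mul_of_pos_right (Nat.lt_floor_add_one _) hδs
      rw [div_mul_cancel₀ s hδs.ne'] at h3
      linarith
    rw [abs_le]; constructor <;> linarith
  have hcl1 : ∀ x, |Real.log (a s x) - Real.log (a s' x)| ≤ ρ := fun x =>
    Real.dist_eq _ _ ▸ Hδ₁ s hs s' hs' (hss'.trans hδs1) x
  have hcl2 : ∀ x, |θ₀ s x - θ₀ s' x| ≤ ρ := fun x => Real.dist_eq _ _ ▸ Hδ₂ s hs s' hs' (hss'.trans hδs2) x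
  have hcl3 : ∀ x, ‖u₀ s x - u₀ s' x‖ ≤ ρ := fun x =>
    dist_eq_norm (u₀ s x) (u₀ s' x) ▸ Hδ₃ s hs s' hs' (hss'.trans hδs3) x
  let P := localGibbsLaw σ (a s) (u₀ s) (θ₀ s) N (Φ N)
  let P' := localGibbsLaw σ (a s') (u₀ s') (θ₀ s') N (Φ N)
  let L := liouville (Torus.geometry (Fin 3)) (N + 1) (hsDiameter σ N)
  have hPac : P ≪ L := by
    show localGibbsLaw σ (a s) (u₀ s) (θ₀ s) N (Φ N) ≪ L
    rw [localGibbsLaw_eq]; exact localGibbsMeasure_absolutelyContinuous σ _ _ _ N (Φ N)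
  have hP'ac : P' ≪ L := by
    show localGibbsLaw σ (a s') (u₀ s') (θ₀ s') N (Φ N) ≪ L
    rw [localGibbsLaw_eq]; exact localGibbsMeasure_absolutelyContinuous σ _ _ _ N (Φ N)
  have hLgood : L (Φ N).goodᶜ = 0 := (Φ N).measure_compl_good
  have hP'good : P' (Φ N).goodᶜ = 0 := mem_ae_iff.1 (hP'ac.ae_le (Φ N).ae_mem_good)
  let q : T3 × V3 → ℝ := fun y => β * F s y
  let q₁ : T3 × V3 → ℝ := fun y => 6 * β * C' * Fn kf y
  let q₂ : T3 × V3 → ℝ := fun y => 6 * Λ * (1 + ‖y.2‖ ^ 2)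
  let q₃ : T3 × V3 → ℝ := fun y => 24 * β₀ * C' * C₃ θM U * C₂ θm U * Gn kf y
  have hqc : Continuous q := continuous_const.mul (hFc_s s)
  have hq₁c : Continuous q₁ := continuous_const.mul (hFnc kf)
  have hq₂c : Continuous q₂ := continuous_const.mul (continuous_const.add ((continuous_norm.comp continuous_snd).pow 2))
  have hq₃c : Continuous q₃ := continuous_const.mul (hGnc kf)
  have hle : ∀ y, 2 * q y ≤ (3 : ℝ)⁻¹ * (q₁ y + q₂ y + q₃ y) := by
    intro y
    have hcmp := KineticWindowGronwallPlusNode.general_compare_avg (θ' := θ₀ s' y.1) (u' := u₀ s' y.1) (Fv := F s y) (F'v := F s' y) hθm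
      (hθm_le s' hs' y.1) (hθM_ge s' hs' y.1) (hU_ge s' hs' y.1) hβabs hη.le hC'0.le hR0
      (hbulk s hs s' hs' (hss'.trans hδs4) y.1 y.2) (hFb s hs y) (hFb s' hs' y) ht0 htR hsplit hα hγ
    have e : q₁ y + q₂ y + q₃ y = 6 * (β * F s' y) + 6 * (β₀ * η + 2 * β₀ * C' * C₃ θM U * ηt * (1 + C₂ θm U)) *
        (1 + ‖y.2‖ ^ 2) + 12 * β₀ * C' * C₃ θM U * t₀ ((Real.sqrt (θ₀ s' y.1))⁻¹ • (y.2 - u₀ s' y.1)) := by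
      show 6 * β * C' * (C'⁻¹ * F s' y) + 6 * Λ * (1 + ‖y.2‖ ^ 2) +
        24 * β₀ * C' * C₃ θM U * C₂ θm U * ((2 * C₂ θm U)⁻¹ * ((fun _ : T3 => (1 : ℝ)) y.1 *
          t₀ ((Real.sqrt (θ₀ s' y.1))⁻¹ • (y.2 - u₀ s' y.1)))) = _
      rw [hΛdef]; field_simp; ring
    rw [e]
    exact hcmp
  let Bd : ENNReal := ENNReal.ofReal (Real.exp (ε' / 2 * ((N : ℝ) + 1)))
  have hB1 : ∫⁻ z, ENNReal.ofReal (Real.exp (∑ i, w⁻¹ * ∫ r in (0 : ℝ)..w, q₁ ((Φ N).flow r z i))) ∂P' ≤ Bd := by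
    refine le_of_eq_of_le (lintegral_congr fun z => ?_) (HN1 kf N ((hN₀1 kf).trans hN))
    rw [KineticWindowGronwallPlusNode.mul_windowSum (Φ N) (Fn kf) (6 * β * C')]
  have hB3 : ∫⁻ z, ENNReal.ofReal (Real.exp (∑ i, w⁻¹ * ∫ r in (0 : ℝ)..w, q₃ ((Φ N).flow r z i))) ∂P' ≤ Bd := by
    refine le_of_eq_of_le (lintegral_congr fun z => ?_) (HN2 kf N ((hN₀2 kf).trans hN))
    rw [KineticWindowGronwallPlusNode.mul_windowSum (Φ N) (Gn kf) (24 * β₀ * C' * C₃ θM U * C₂ θm U)]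
  have hB2 : ∫⁻ z, ENNReal.ofReal (Real.exp (∑ i, w⁻¹ * ∫ r in (0 : ℝ)..w, q₂ ((Φ N).flow r z i))) ∂P' ≤ Bd := by
    have h := HE (a s') (θ₀ s') (u₀ s') (hac_s _) (hθc_s _) (huc_s _) (ha0 _) (hθ0 _) (hθM_ge _ hs')
      (hU_ge _ hs') σ hσ hσ2 N (Φ N) (6 * Λ) hlam0 hlamle w hw
    refine h.trans (ENNReal.ofReal_le_ofReal (Real.exp_le_exp.2 ?_))
    exact mul_le_mul_of_nonneg_right hCElam hN1pos.le
  have hdouble : ∫⁻ z, ENNReal.ofReal (Real.exp (2 * ∑ i, w⁻¹ * ∫ r in (0 : ℝ)..w, q ((Φ N).flow r z i))) ∂P' ≤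
      Bd :=
    lintegral_exp_window_le_of_le_three (Φ N) hP'good hqc hq₁c hq₂c hq₃c hle hw.le hB1 hB2 hB3
  let G : Config (N + 1) (Fin 3) T3 → ENNReal := fun z =>
    ENNReal.ofReal (Real.exp (∑ i, w⁻¹ * ∫ r in (0 : ℝ)..w, q ((Φ N).flow r z i)))
  have hGae : AEMeasurable G L :=
    (Real.measurable_exp.comp_aemeasurable
      (KineticWindowGronwallProductKineticInstance.aemeasurable_windowSum (Φ N) hLgood hqc w)).ennreal_ofReal
  have HT' := HT (a s) (a s') (θ₀ s) (θ₀ s') (u₀ s) (u₀ s') (hac_s _) (hac_s _) (hθc_s _) (hθc_s _)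
    (huc_s _) (huc_s _) (ha0 _) (ha0 _) (hθm_le s hs) (hθM_ge s hs) (hθm_le s' hs') (hθM_ge s' hs')
    hcl1 hcl2 hcl3 σ hσ hσ2 N (Φ N)
  have hchange : ∫⁻ z, G z ∂P ≤
      ENNReal.ofReal (Real.exp (ε' / 4 * ((N : ℝ) + 1))) * (∫⁻ z, G z ^ (2 : ℝ) ∂P') ^ (1 / 2 : ℝ) :=
    lintegral_le_of_forall_measurable hPac hP'ac HT' hGae
  have hG2 : ∫⁻ z, G z ^ (2 : ℝ) ∂P' ≤ Bd := by
    refine le_of_eq_of_le (lintegral_congr fun z => ?_) hdouble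
    exact (KineticWindowGronwallWindowSubadditivity.ofReal_exp_mul_left 2 _ zero_le_two).symm
  have hhalf : Bd ^ (1 / 2 : ℝ) = ENNReal.ofReal (Real.exp ((1 / 2 : ℝ) * (ε' / 2 * ((N : ℝ) + 1)))) :=
    (KineticWindowGronwallWindowSubadditivity.ofReal_exp_mul_left (1 / 2 : ℝ) _ (by norm_num)).symm
  have hgoal : ∫⁻ z, G z ∂P ≤ ENNReal.ofReal (Real.exp (ε * ((N : ℝ) + 1))) :=
    calc ∫⁻ z, G z ∂P
        ≤ ENNReal.ofReal (Real.exp (ε' / 4 * ((N : ℝ) + 1))) * (∫⁻ z, G z ^ (2 : ℝ) ∂P') ^ (1 / 2 : ℝ) := hchange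
      _ ≤ ENNReal.ofReal (Real.exp (ε' / 4 * ((N : ℝ) + 1))) * Bd ^ (1 / 2 : ℝ) :=
          mul_le_mul_right (ENNReal.rpow_le_rpow hG2 (by norm_num)) _
      _ = ENNReal.ofReal (Real.exp ((ε' / 4 + ε' / 4) * ((N : ℝ) + 1))) := by
          rw [hhalf, ← ENNReal.ofReal_mul (Real.exp_pos _).le, ← Real.exp_add]
          congr 2; ring
      _ ≤ ENNReal.ofReal (Real.exp (ε * ((N : ℝ) + 1))) := by
          refine ENNReal.ofReal_le_ofReal (Real.exp_le_exp.2 (mul_le_mul_of_nonneg_right ?_ hN1pos.le))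
          linarith
  refine le_of_eq_of_le (lintegral_congr fun z => ?_) hgoal
  rw [KineticWindowGronwallPlusNode.mul_windowSum (Φ N) (F s) β]

end Summit.AtomisticToContinuum.HydrodynamicLimit.Theorems.KineticWindowGronwallFamilyGlue

end
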